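import Summits.ResolutionOfSingularities.ResolutionOfSingularities.Theorems.FrobeniusLadderFInjectiveMacaulayficationP2d4F5Specimen
import Mathlib.RingTheory.AdjoinRoot
import Mathlib.RingTheory.Flat.Localization
import Mathlib.RingTheory.Flat.TorsionFree
import Mathlib.RingTheory.Localization.Away.Basic
import HarnessLib

/-!
# (N1-Y) The Rees chart `D(ȳ²)` of `Bl_τ(P2d4F5)` as an ITERATED MONIC EXTENSION of `k[y, V₀, V₁, V₂]` — tower algebra, chart map, blow-down map
# (crux `FInjectiveMacaulayfication` stmt-ResolutionOfSingularities-15315, chain w45a; res-L1-w45a-plan-1 R18.32 «(N1) ROW #2 TWO-SIDED → stub-3»;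
# seat res-L1-w45a-stub-3 g10)

[OURS · L1 W4.5a] Support file (`--supports stmt-ResolutionOfSingularities-15315 --as helper`); replaces the role of NO printed item; NOT a statement of
any manuscript; def-free (the tower polynomials are hypotheses `h₁ h₂ h₃` with their defining equations); UNCONDITIONAL; characteristic-free. AI-written
(AI review is weaker than expert review).

SETTING. `A₀ = k[X0..X4]/(f)`, `f = X4² + X0²X4 + X1⁵ + X2⁵ + X3⁵` (P2d4F5: `x,y,u,t,z = X0..X4`), `τ = (x̄, ȳ², ū², t̄², z̄)` (res-L1-w45a-plan-1's τ-centre;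
res-L1-w45a-stub-2's p627561 spelling `Ideal.span {x̄0, x̄1², x̄2², x̄3², x̄4}`). The chart `D(ȳ²)` of `Bl_τ X` has ring `A₀[τ/ȳ²] = A₀[x/y², u²/y², t²/y², z/y²]`
(res-L1-w45a-idea-1 `fb5r4/tau/tau-P2d4F5-floor1.json`: 7 variables `y,u,t,V₁,V₂,V₀,V₄`, codim-3 CI `u² = y²V₁`, `t² = y²V₂`, `V₄² + y²V₀²V₄ + y + uV₁² + tV₂² = 0`).
We type it as the TOWER `T₃ = B₀[u][t][V₄]`, `B₀ = k[y,V₀,V₁,V₂] = MvPolynomial (Fin 4) k` (`X 0 = y`, `X 1 = V₀`, `X 2 = V₁`, `X 3 = V₂`):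
`T₁ = AdjoinRoot h₁`, `h₁ = U² − y²V₁`; `T₂ = AdjoinRoot h₂`, `h₂ = T² − y²V₂`; `T₃ = AdjoinRoot h₃`, `h₃ = V² + y²V₀²·V + (y + V₁²u + V₂²t)` — each MONIC, so
`T₃` is FREE of rank 8 and FINITE over `B₀` (§1: `free_tower`, `finite_tower`; Mathlib `AdjoinRoot.powerBasis'`), which is what the generic CM engine
`FlatIntegralCM` (res-L1-w45a-stub-3 g10) and the injectivity of the chart map consume.
* §1 the tower: monicity, the three relations in `T₃`, `Module.Free`/`Module.Finite`/`IsScalarTower` bookkeeping, `y² ∈ T₃` a non-zero-divisor (flatness);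
* §2 ring-hom extensionality out of the tower (`tower_ringHom_ext`: two ring maps `T₃ → S` agreeing on `B₀`, `u`, `t`, `V₄` agree);
* §3 ★ `exists_chartMap` — `φ : T₃ →+* A₀[1/ȳ²]`, `y,V₀,V₁,V₂,u,t,V₄ ↦ ȳ, x̄/ȳ², ū²/ȳ², t̄²/ȳ², ū, t̄, z̄/ȳ²` (`h₃ ↦ f/ȳ⁴ = 0`);
* §4 ★ `exists_blowdownMap` — `ψ₁ : A₀ →+* T₃`, `X0..X4 ↦ y²V₀, y, u, t, y²V₄` (`f ↦ y⁴·h₃(V₄) + u(u²+y²V₁)·h₁(u) + t(t²+y²V₂)·h₂(t) = 0`).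
The identification `T₃ ≃+* blowupAlgebra τ ȳ²` is the sequel file. [cite: GortzWedhorn2020, (13.19) p. 415] [cite: StacksProject, Tag 0804]
-/

-- single-problem summit: the doubled namespace component is forced
set_option linter.dupNamespace false

noncomputable section

namespace Summit.ResolutionOfSingularities.ResolutionOfSingularities.Theorems.FInjectiveMacaulayfication.TauFloorF5YChartAlgebra

open MvPolynomial IsLocalization
open Summit.ResolutionOfSingularities.ResolutionOfSingularities.Theorems.FInjectiveMacaulayfication

variable (k : Type) [Field k]

/-! ## §1 The tower `T₃ = k[y,V₀,V₁,V₂][u][t][V₄]` -/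

/-- `h₁ = U² − y²V₁` is monic. [plumbing] -/
theorem monic_h₁ (h₁ : Polynomial (MvPolynomial (Fin 4) k)) (hh₁ : h₁ = Polynomial.X ^ 2 - Polynomial.C (X 0 ^ 2 * X 2)) : h₁.Monic := by
  rw [hh₁]; exact Polynomial.monic_X_pow_sub_C _ two_ne_zero

/-- `h₂ = T² − y²V₂` is monic. [plumbing] -/
theorem monic_h₂ (h₁ : Polynomial (MvPolynomial (Fin 4) k)) (h₂ : Polynomial (AdjoinRoot h₁))
    (hh₂ : h₂ = Polynomial.X ^ 2 - Polynomial.C (algebraMap (MvPolynomial (Fin 4) k) (AdjoinRoot h₁) (X 0 ^ 2 * X 3))) : h₂.Monic := by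
  rw [hh₂]; exact Polynomial.monic_X_pow_sub_C _ two_ne_zero

/-- `h₃ = V² + y²V₀²·V + (y + V₁²u + V₂²t)` is monic. [plumbing] -/
theorem monic_h₃ (h₁ : Polynomial (MvPolynomial (Fin 4) k)) (h₂ : Polynomial (AdjoinRoot h₁)) (h₃ : Polynomial (AdjoinRoot h₂))
    (hh₃ : h₃ = Polynomial.X ^ 2 + (Polynomial.C (algebraMap (MvPolynomial (Fin 4) k) (AdjoinRoot h₂) (X 0 ^ 2 * X 1 ^ 2)) * Polynomial.X +
      Polynomial.C (algebraMap (MvPolynomial (Fin 4) k) (AdjoinRoot h₂) (X 0) +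
        algebraMap (MvPolynomial (Fin 4) k) (AdjoinRoot h₂) (X 2 ^ 2) * AdjoinRoot.of h₂ (AdjoinRoot.root h₁) +
        algebraMap (MvPolynomial (Fin 4) k) (AdjoinRoot h₂) (X 3 ^ 2) * AdjoinRoot.root h₂))) : h₃.Monic := by
  rw [hh₃]
  nontriviality (AdjoinRoot h₂)
  refine Polynomial.monic_X_pow_add ?_
  refine (Polynomial.degree_add_le _ _).trans_lt ?_
  refine max_lt ((Polynomial.degree_C_mul_X_le _).trans_lt (by exact_mod_cast Nat.lt_succ_self 1)) ?_
  exact (Polynomial.degree_C_le).trans_lt (by exact_mod_cast Nat.succ_pos 1)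

/-- `T₁` is free and finite over `B₀`. [Mathlib `AdjoinRoot.powerBasis'`] -/
theorem free_finite₁ (h₁ : Polynomial (MvPolynomial (Fin 4) k)) (hh₁ : h₁ = Polynomial.X ^ 2 - Polynomial.C (X 0 ^ 2 * X 2)) :
    Module.Free (MvPolynomial (Fin 4) k) (AdjoinRoot h₁) ∧ Module.Finite (MvPolynomial (Fin 4) k) (AdjoinRoot h₁) :=
  ⟨Module.Free.of_basis (AdjoinRoot.powerBasis' (monic_h₁ k h₁ hh₁)).basis, (AdjoinRoot.powerBasis' (monic_h₁ k h₁ hh₁)).finite⟩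

/-- `T₂` is free and finite over `T₁`. [Mathlib `AdjoinRoot.powerBasis'`] -/
theorem free_finite₂ (h₁ : Polynomial (MvPolynomial (Fin 4) k)) (h₂ : Polynomial (AdjoinRoot h₁))
    (hh₂ : h₂ = Polynomial.X ^ 2 - Polynomial.C (algebraMap (MvPolynomial (Fin 4) k) (AdjoinRoot h₁) (X 0 ^ 2 * X 3))) :
    Module.Free (AdjoinRoot h₁) (AdjoinRoot h₂) ∧ Module.Finite (AdjoinRoot h₁) (AdjoinRoot h₂) :=
  ⟨Module.Free.of_basis (AdjoinRoot.powerBasis' (monic_h₂ k h₁ h₂ hh₂)).basis, (AdjoinRoot.powerBasis' (monic_h₂ k h₁ h₂ hh₂)).finite⟩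

/-- `T₃` is free and finite over `T₂`. [Mathlib `AdjoinRoot.powerBasis'`] -/
theorem free_finite₃ (h₁ : Polynomial (MvPolynomial (Fin 4) k)) (h₂ : Polynomial (AdjoinRoot h₁)) (h₃ : Polynomial (AdjoinRoot h₂))
    (hh₃ : h₃ = Polynomial.X ^ 2 + (Polynomial.C (algebraMap (MvPolynomial (Fin 4) k) (AdjoinRoot h₂) (X 0 ^ 2 * X 1 ^ 2)) * Polynomial.X +
      Polynomial.C (algebraMap (MvPolynomial (Fin 4) k) (AdjoinRoot h₂) (X 0) +
        algebraMap (MvPolynomial (Fin 4) k) (AdjoinRoot h₂) (X 2 ^ 2) * AdjoinRoot.of h₂ (AdjoinRoot.root h₁) +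
        algebraMap (MvPolynomial (Fin 4) k) (AdjoinRoot h₂) (X 3 ^ 2) * AdjoinRoot.root h₂))) :
    Module.Free (AdjoinRoot h₂) (AdjoinRoot h₃) ∧ Module.Finite (AdjoinRoot h₂) (AdjoinRoot h₃) :=
  ⟨Module.Free.of_basis (AdjoinRoot.powerBasis' (monic_h₃ k h₁ h₂ h₃ hh₃)).basis, (AdjoinRoot.powerBasis' (monic_h₃ k h₁ h₂ h₃ hh₃)).finite⟩

/-- ★ **`T₃` is FREE and FINITE over `B₀ = k[y,V₀,V₁,V₂]`** (transitivity along the tower). [folklore] -/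
theorem free_finite_tower (h₁ : Polynomial (MvPolynomial (Fin 4) k)) (hh₁ : h₁ = Polynomial.X ^ 2 - Polynomial.C (X 0 ^ 2 * X 2))
    (h₂ : Polynomial (AdjoinRoot h₁)) (hh₂ : h₂ = Polynomial.X ^ 2 - Polynomial.C (algebraMap (MvPolynomial (Fin 4) k) (AdjoinRoot h₁) (X 0 ^ 2 * X 3)))
    (h₃ : Polynomial (AdjoinRoot h₂))
    (hh₃ : h₃ = Polynomial.X ^ 2 + (Polynomial.C (algebraMap (MvPolynomial (Fin 4) k) (AdjoinRoot h₂) (X 0 ^ 2 * X 1 ^ 2)) * Polynomial.X +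
      Polynomial.C (algebraMap (MvPolynomial (Fin 4) k) (AdjoinRoot h₂) (X 0) +
        algebraMap (MvPolynomial (Fin 4) k) (AdjoinRoot h₂) (X 2 ^ 2) * AdjoinRoot.of h₂ (AdjoinRoot.root h₁) +
        algebraMap (MvPolynomial (Fin 4) k) (AdjoinRoot h₂) (X 3 ^ 2) * AdjoinRoot.root h₂))) :
    Module.Free (MvPolynomial (Fin 4) k) (AdjoinRoot h₃) ∧ Module.Finite (MvPolynomial (Fin 4) k) (AdjoinRoot h₃) := by
  obtain ⟨hf₁, hfi₁⟩ := free_finite₁ k h₁ hh₁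
  obtain ⟨hf₂, hfi₂⟩ := free_finite₂ k h₁ h₂ hh₂
  obtain ⟨hf₃, hfi₃⟩ := free_finite₃ k h₁ h₂ h₃ hh₃
  haveI : Module.Free (MvPolynomial (Fin 4) k) (AdjoinRoot h₂) := Module.Free.trans (S := AdjoinRoot h₁)
  haveI : Module.Finite (MvPolynomial (Fin 4) k) (AdjoinRoot h₂) := Module.Finite.trans (AdjoinRoot h₁) (AdjoinRoot h₂)
  exact ⟨Module.Free.trans (S := AdjoinRoot h₂), Module.Finite.trans (AdjoinRoot h₂) (AdjoinRoot h₃)⟩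

/-- The relation `u² = y²V₁` in `T₁`. [plumbing] -/
theorem root₁_sq (h₁ : Polynomial (MvPolynomial (Fin 4) k)) (hh₁ : h₁ = Polynomial.X ^ 2 - Polynomial.C (X 0 ^ 2 * X 2)) :
    AdjoinRoot.root h₁ ^ 2 = AdjoinRoot.of h₁ (X 0 ^ 2 * X 2) := by
  subst hh₁
  have h := AdjoinRoot.eval₂_root (Polynomial.X ^ 2 - Polynomial.C (X 0 ^ 2 * X 2 : MvPolynomial (Fin 4) k))
  rw [Polynomial.eval₂_sub, Polynomial.eval₂_X_pow, Polynomial.eval₂_C, sub_eq_zero] at h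
  exact h

/-- The relation `t² = y²V₂` in `T₂`. [plumbing] -/
theorem root₂_sq (h₁ : Polynomial (MvPolynomial (Fin 4) k)) (h₂ : Polynomial (AdjoinRoot h₁))
    (hh₂ : h₂ = Polynomial.X ^ 2 - Polynomial.C (algebraMap (MvPolynomial (Fin 4) k) (AdjoinRoot h₁) (X 0 ^ 2 * X 3))) :
    AdjoinRoot.root h₂ ^ 2 = algebraMap (MvPolynomial (Fin 4) k) (AdjoinRoot h₂) (X 0 ^ 2 * X 3) := by
  rw [IsScalarTower.algebraMap_apply (MvPolynomial (Fin 4) k) (AdjoinRoot h₁) (AdjoinRoot h₂), AdjoinRoot.algebraMap_eq h₂]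
  subst hh₂
  have h := AdjoinRoot.eval₂_root (Polynomial.X ^ 2 - Polynomial.C (algebraMap (MvPolynomial (Fin 4) k) (AdjoinRoot h₁) (X 0 ^ 2 * X 3)))
  rw [Polynomial.eval₂_sub, Polynomial.eval₂_X_pow, Polynomial.eval₂_C, sub_eq_zero] at h
  exact h

/-- The relation `V₄² + y²V₀²·V₄ + (y + V₁²u + V₂²t) = 0` in `T₃`. [plumbing] -/
theorem root₃_rel (h₁ : Polynomial (MvPolynomial (Fin 4) k)) (h₂ : Polynomial (AdjoinRoot h₁)) (h₃ : Polynomial (AdjoinRoot h₂))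
    (hh₃ : h₃ = Polynomial.X ^ 2 + (Polynomial.C (algebraMap (MvPolynomial (Fin 4) k) (AdjoinRoot h₂) (X 0 ^ 2 * X 1 ^ 2)) * Polynomial.X +
      Polynomial.C (algebraMap (MvPolynomial (Fin 4) k) (AdjoinRoot h₂) (X 0) +
        algebraMap (MvPolynomial (Fin 4) k) (AdjoinRoot h₂) (X 2 ^ 2) * AdjoinRoot.of h₂ (AdjoinRoot.root h₁) +
        algebraMap (MvPolynomial (Fin 4) k) (AdjoinRoot h₂) (X 3 ^ 2) * AdjoinRoot.root h₂))) :
    AdjoinRoot.root h₃ ^ 2 + algebraMap (MvPolynomial (Fin 4) k) (AdjoinRoot h₃) (X 0 ^ 2 * X 1 ^ 2) * AdjoinRoot.root h₃ +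
      (algebraMap (MvPolynomial (Fin 4) k) (AdjoinRoot h₃) (X 0) +
        algebraMap (MvPolynomial (Fin 4) k) (AdjoinRoot h₃) (X 2 ^ 2) * algebraMap (AdjoinRoot h₁) (AdjoinRoot h₃) (AdjoinRoot.root h₁) +
        algebraMap (MvPolynomial (Fin 4) k) (AdjoinRoot h₃) (X 3 ^ 2) * AdjoinRoot.of h₃ (AdjoinRoot.root h₂)) = 0 := by
  have e0 : ∀ b : MvPolynomial (Fin 4) k, algebraMap (MvPolynomial (Fin 4) k) (AdjoinRoot h₃) b =
      AdjoinRoot.of h₃ (algebraMap (MvPolynomial (Fin 4) k) (AdjoinRoot h₂) b) := fun b => by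
    rw [IsScalarTower.algebraMap_apply (MvPolynomial (Fin 4) k) (AdjoinRoot h₂) (AdjoinRoot h₃), AdjoinRoot.algebraMap_eq h₃]
  have e1 : algebraMap (AdjoinRoot h₁) (AdjoinRoot h₃) (AdjoinRoot.root h₁) = AdjoinRoot.of h₃ (AdjoinRoot.of h₂ (AdjoinRoot.root h₁)) := by
    rw [IsScalarTower.algebraMap_apply (AdjoinRoot h₁) (AdjoinRoot h₂) (AdjoinRoot h₃), AdjoinRoot.algebraMap_eq h₃, AdjoinRoot.algebraMap_eq h₂]
  rw [e0, e0, e0, e0, e1]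
  subst hh₃
  have h := AdjoinRoot.eval₂_root (Polynomial.X ^ 2 + (Polynomial.C (algebraMap (MvPolynomial (Fin 4) k) (AdjoinRoot h₂) (X 0 ^ 2 * X 1 ^ 2)) * Polynomial.X +
      Polynomial.C (algebraMap (MvPolynomial (Fin 4) k) (AdjoinRoot h₂) (X 0) +
        algebraMap (MvPolynomial (Fin 4) k) (AdjoinRoot h₂) (X 2 ^ 2) * AdjoinRoot.of h₂ (AdjoinRoot.root h₁) +
        algebraMap (MvPolynomial (Fin 4) k) (AdjoinRoot h₂) (X 3 ^ 2) * AdjoinRoot.root h₂)))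
  simp only [Polynomial.eval₂_add, Polynomial.eval₂_mul, Polynomial.eval₂_X_pow, Polynomial.eval₂_C, Polynomial.eval₂_X] at h
  simp only [map_add, map_mul, map_pow] at h ⊢
  linear_combination h

/-! ## §2 Ring maps out of the tower are determined by `B₀`, `u`, `t`, `V₄` -/

/-- Ring-hom extensionality out of `AdjoinRoot g`: agree on `R` and on the root. [folklore] -/
theorem adjoinRoot_ringHom_ext {R S : Type} [CommRing R] [CommRing S] {g : Polynomial R} {φ ψ : AdjoinRoot g →+* S}
    (h0 : ∀ r : R, φ (AdjoinRoot.of g r) = ψ (AdjoinRoot.of g r)) (h1 : φ (AdjoinRoot.root g) = ψ (AdjoinRoot.root g)) : φ = ψ := by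
  apply Ideal.Quotient.ringHom_ext
  exact Polynomial.ringHom_ext (fun r => h0 r) h1

/-- ★ **Extensionality out of `T₃`**: two ring maps `T₃ → S` agreeing on `k`, on `y,V₀,V₁,V₂`, on `u`, `t` and `V₄` are equal. [folklore] -/
theorem tower_ringHom_ext {S : Type} [CommRing S] (h₁ : Polynomial (MvPolynomial (Fin 4) k)) (h₂ : Polynomial (AdjoinRoot h₁))
    (h₃ : Polynomial (AdjoinRoot h₂)) {φ ψ : AdjoinRoot h₃ →+* S}
    (hC : ∀ a : k, φ (algebraMap (MvPolynomial (Fin 4) k) (AdjoinRoot h₃) (C a)) = ψ (algebraMap (MvPolynomial (Fin 4) k) (AdjoinRoot h₃) (C a)))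
    (hX : ∀ i : Fin 4, φ (algebraMap (MvPolynomial (Fin 4) k) (AdjoinRoot h₃) (X i)) = ψ (algebraMap (MvPolynomial (Fin 4) k) (AdjoinRoot h₃) (X i)))
    (hu : φ (algebraMap (AdjoinRoot h₁) (AdjoinRoot h₃) (AdjoinRoot.root h₁)) = ψ (algebraMap (AdjoinRoot h₁) (AdjoinRoot h₃) (AdjoinRoot.root h₁)))
    (ht : φ (AdjoinRoot.of h₃ (AdjoinRoot.root h₂)) = ψ (AdjoinRoot.of h₃ (AdjoinRoot.root h₂)))
    (hV : φ (AdjoinRoot.root h₃) = ψ (AdjoinRoot.root h₃)) : φ = ψ := by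
  refine adjoinRoot_ringHom_ext (fun r => ?_) hV
  -- agree on `T₂`
  have h2 : φ.comp (AdjoinRoot.of h₃) = ψ.comp (AdjoinRoot.of h₃) := by
    refine adjoinRoot_ringHom_ext (fun r₁ => ?_) ht
    -- agree on `T₁`
    have h1 : (φ.comp (AdjoinRoot.of h₃)).comp (AdjoinRoot.of h₂) = (ψ.comp (AdjoinRoot.of h₃)).comp (AdjoinRoot.of h₂) := by
      refine adjoinRoot_ringHom_ext (fun b => ?_) ?_
      · -- agree on `B₀`
        have h0 : ((φ.comp (AdjoinRoot.of h₃)).comp (AdjoinRoot.of h₂)).comp (AdjoinRoot.of h₁) =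
            ((ψ.comp (AdjoinRoot.of h₃)).comp (AdjoinRoot.of h₂)).comp (AdjoinRoot.of h₁) := by
          refine MvPolynomial.ringHom_ext (fun a => ?_) (fun i => ?_)
          · have := hC a
            simp only [RingHom.comp_apply]
            rwa [IsScalarTower.algebraMap_apply (MvPolynomial (Fin 4) k) (AdjoinRoot h₂) (AdjoinRoot h₃),
              IsScalarTower.algebraMap_apply (MvPolynomial (Fin 4) k) (AdjoinRoot h₁) (AdjoinRoot h₂), AdjoinRoot.algebraMap_eq,
              AdjoinRoot.algebraMap_eq, AdjoinRoot.algebraMap_eq] at this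
          · have := hX i
            simp only [RingHom.comp_apply]
            rwa [IsScalarTower.algebraMap_apply (MvPolynomial (Fin 4) k) (AdjoinRoot h₂) (AdjoinRoot h₃),
              IsScalarTower.algebraMap_apply (MvPolynomial (Fin 4) k) (AdjoinRoot h₁) (AdjoinRoot h₂), AdjoinRoot.algebraMap_eq,
              AdjoinRoot.algebraMap_eq, AdjoinRoot.algebraMap_eq] at this
        exact RingHom.congr_fun h0 b
      · have := hu
        simp only [RingHom.comp_apply]
        rwa [IsScalarTower.algebraMap_apply (AdjoinRoot h₁) (AdjoinRoot h₂) (AdjoinRoot h₃), AdjoinRoot.algebraMap_eq,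
          AdjoinRoot.algebraMap_eq] at this
    exact RingHom.congr_fun h1 r₁
  exact RingHom.congr_fun h2 r


/-! ## §3a Abstract ring identities (atoms generalized: cheap for the kernel) -/

/-- `u² − y²·(u²·i) = 0` when `y²·i = 1`. [ring identity] -/
theorem ident_sq {L : Type} [CommRing L] (y u i : L) (hyi : y ^ 2 * i = 1) : u ^ 2 - y ^ 2 * (u ^ 2 * i) = 0 := by
  linear_combination (-(u ^ 2)) * hyi

/-- `h₃(z·i) = i²·f` when `y²·i = 1`: `(zi)² + y²(xi)²(zi) + (y + (u²i)²u + (t²i)²t) = 0`. [ring identity] -/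
theorem ident_h₃ {L : Type} [CommRing L] (x y z u t i : L) (hF : z ^ 2 + x ^ 2 * z + y ^ 5 + u ^ 5 + t ^ 5 = 0) (hyi : y ^ 2 * i = 1) :
    (z * i) ^ 2 + (y ^ 2 * (x * i) ^ 2 * (z * i) + (y + (u ^ 2 * i) ^ 2 * u + (t ^ 2 * i) ^ 2 * t)) = 0 := by
  linear_combination i ^ 2 * hF + (x ^ 2 * z * i ^ 2 - y * (y ^ 2 * i + 1)) * hyi

/-- `f(y²V₀, y, u, t, y²V₄) = y⁴·h₃ + u(u²+y²V₁)·h₁ + t(t²+y²V₂)·h₂`. [ring identity] -/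
theorem ident_blowdown {T : Type} [CommRing T] (y V₀ V₁ V₂ u t V : T) (R1 : u ^ 2 = y ^ 2 * V₁) (R2 : t ^ 2 = y ^ 2 * V₂)
    (R3 : V ^ 2 + y ^ 2 * V₀ ^ 2 * V + (y + V₁ ^ 2 * u + V₂ ^ 2 * t) = 0) :
    (y ^ 2 * V) ^ 2 + (y ^ 2 * V₀) ^ 2 * (y ^ 2 * V) + y ^ 5 + u ^ 5 + t ^ 5 = 0 := by
  linear_combination (y ^ 4) * R3 + (u * (u ^ 2 + y ^ 2 * V₁)) * R1 + (t * (t ^ 2 + y ^ 2 * V₂)) * R2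

/-! ## §3 The chart map `φ : T₃ → A₀[1/ȳ²]` -/

/-- In `A₀[1/ȳ²]`: the image of `f` vanishes, expanded. [plumbing] -/
theorem f_rel_away (f : MvPolynomial (Fin 5) k) (hf : f = X 4 ^ 2 + X 0 ^ 2 * X 4 + X 1 ^ 5 + X 2 ^ 5 + X 3 ^ 5) :
    algebraMap (MvPolynomial (Fin 5) k ⧸ Ideal.span {f}) (Localization.Away (Ideal.Quotient.mk (Ideal.span {f}) (X 1) ^ 2 : MvPolynomial (Fin 5) k ⧸ Ideal.span {f}))
        (Ideal.Quotient.mk (Ideal.span {f}) (X 4)) ^ 2 +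
      algebraMap (MvPolynomial (Fin 5) k ⧸ Ideal.span {f}) (Localization.Away (Ideal.Quotient.mk (Ideal.span {f}) (X 1) ^ 2 : MvPolynomial (Fin 5) k ⧸ Ideal.span {f}))
        (Ideal.Quotient.mk (Ideal.span {f}) (X 0)) ^ 2 *
      algebraMap (MvPolynomial (Fin 5) k ⧸ Ideal.span {f}) (Localization.Away (Ideal.Quotient.mk (Ideal.span {f}) (X 1) ^ 2 : MvPolynomial (Fin 5) k ⧸ Ideal.span {f}))
        (Ideal.Quotient.mk (Ideal.span {f}) (X 4)) +
      algebraMap (MvPolynomial (Fin 5) k ⧸ Ideal.span {f}) (Localization.Away (Ideal.Quotient.mk (Ideal.span {f}) (X 1) ^ 2 : MvPolynomial (Fin 5) k ⧸ Ideal.span {f}))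
        (Ideal.Quotient.mk (Ideal.span {f}) (X 1)) ^ 5 +
      algebraMap (MvPolynomial (Fin 5) k ⧸ Ideal.span {f}) (Localization.Away (Ideal.Quotient.mk (Ideal.span {f}) (X 1) ^ 2 : MvPolynomial (Fin 5) k ⧸ Ideal.span {f}))
        (Ideal.Quotient.mk (Ideal.span {f}) (X 2)) ^ 5 +
      algebraMap (MvPolynomial (Fin 5) k ⧸ Ideal.span {f}) (Localization.Away (Ideal.Quotient.mk (Ideal.span {f}) (X 1) ^ 2 : MvPolynomial (Fin 5) k ⧸ Ideal.span {f}))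
        (Ideal.Quotient.mk (Ideal.span {f}) (X 3)) ^ 5 = 0 := by
  have h0 : Ideal.Quotient.mk (Ideal.span {f}) (X 4 ^ 2 + X 0 ^ 2 * X 4 + X 1 ^ 5 + X 2 ^ 5 + X 3 ^ 5 : MvPolynomial (Fin 5) k) = 0 := by
    rw [← hf]; exact Ideal.Quotient.eq_zero_iff_mem.mpr (Ideal.mem_span_singleton_self f)
  have h1 := congrArg (algebraMap (MvPolynomial (Fin 5) k ⧸ Ideal.span {f})
    (Localization.Away (Ideal.Quotient.mk (Ideal.span {f}) (X 1) ^ 2 : MvPolynomial (Fin 5) k ⧸ Ideal.span {f}))) h0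
  rw [map_zero] at h1
  simpa only [map_add, map_mul, map_pow] using h1

set_option maxHeartbeats 800000 in
-- three `AdjoinRoot.lift`s into `A₀[1/ȳ²]`, each with one ring identity
/-- ★ **The chart map** `φ : T₃ →+* A₀[1/ȳ²]`: `y ↦ ȳ`, `V₀ ↦ x̄/ȳ²`, `V₁ ↦ ū²/ȳ²`, `V₂ ↦ t̄²/ȳ²`, `u ↦ ū`, `t ↦ t̄`, `V₄ ↦ z̄/ȳ²`, constants to constants
(`h₁ ↦ ū² − ȳ²·ū²/ȳ² = 0`, `h₂` likewise, `h₃ ↦ ȳ⁻⁴·f = 0`). [cite: GortzWedhorn2020, (13.19) p. 415] -/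
theorem exists_chartMap (f : MvPolynomial (Fin 5) k) (hf : f = X 4 ^ 2 + X 0 ^ 2 * X 4 + X 1 ^ 5 + X 2 ^ 5 + X 3 ^ 5)
    (h₁ : Polynomial (MvPolynomial (Fin 4) k)) (hh₁ : h₁ = Polynomial.X ^ 2 - Polynomial.C (X 0 ^ 2 * X 2))
    (h₂ : Polynomial (AdjoinRoot h₁)) (hh₂ : h₂ = Polynomial.X ^ 2 - Polynomial.C (algebraMap (MvPolynomial (Fin 4) k) (AdjoinRoot h₁) (X 0 ^ 2 * X 3)))
    (h₃ : Polynomial (AdjoinRoot h₂))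
    (hh₃ : h₃ = Polynomial.X ^ 2 + (Polynomial.C (algebraMap (MvPolynomial (Fin 4) k) (AdjoinRoot h₂) (X 0 ^ 2 * X 1 ^ 2)) * Polynomial.X +
      Polynomial.C (algebraMap (MvPolynomial (Fin 4) k) (AdjoinRoot h₂) (X 0) +
        algebraMap (MvPolynomial (Fin 4) k) (AdjoinRoot h₂) (X 2 ^ 2) * AdjoinRoot.of h₂ (AdjoinRoot.root h₁) +
        algebraMap (MvPolynomial (Fin 4) k) (AdjoinRoot h₂) (X 3 ^ 2) * AdjoinRoot.root h₂))) :
    ∃ φ : AdjoinRoot h₃ →+* Localization.Away (Ideal.Quotient.mk (Ideal.span {f}) (X 1) ^ 2 : MvPolynomial (Fin 5) k ⧸ Ideal.span {f}),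
      (∀ a : k, φ (algebraMap (MvPolynomial (Fin 4) k) (AdjoinRoot h₃) (C a)) =
        algebraMap (MvPolynomial (Fin 5) k ⧸ Ideal.span {f}) _ (Ideal.Quotient.mk (Ideal.span {f}) (C a))) ∧
      (∀ i : Fin 4, φ (algebraMap (MvPolynomial (Fin 4) k) (AdjoinRoot h₃) (X i)) =
        ![algebraMap (MvPolynomial (Fin 5) k ⧸ Ideal.span {f}) _ (Ideal.Quotient.mk (Ideal.span {f}) (X 1)),
          algebraMap (MvPolynomial (Fin 5) k ⧸ Ideal.span {f}) _ (Ideal.Quotient.mk (Ideal.span {f}) (X 0)) * Away.invSelf (Ideal.Quotient.mk (Ideal.span {f}) (X 1) ^ 2),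
          algebraMap (MvPolynomial (Fin 5) k ⧸ Ideal.span {f}) _ (Ideal.Quotient.mk (Ideal.span {f}) (X 2)) ^ 2 * Away.invSelf (Ideal.Quotient.mk (Ideal.span {f}) (X 1) ^ 2),
          algebraMap (MvPolynomial (Fin 5) k ⧸ Ideal.span {f}) _ (Ideal.Quotient.mk (Ideal.span {f}) (X 3)) ^ 2 * Away.invSelf (Ideal.Quotient.mk (Ideal.span {f}) (X 1) ^ 2)] i) ∧
      φ (algebraMap (AdjoinRoot h₁) (AdjoinRoot h₃) (AdjoinRoot.root h₁)) =
        algebraMap (MvPolynomial (Fin 5) k ⧸ Ideal.span {f}) _ (Ideal.Quotient.mk (Ideal.span {f}) (X 2)) ∧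
      φ (AdjoinRoot.of h₃ (AdjoinRoot.root h₂)) = algebraMap (MvPolynomial (Fin 5) k ⧸ Ideal.span {f}) _ (Ideal.Quotient.mk (Ideal.span {f}) (X 3)) ∧
      φ (AdjoinRoot.root h₃) =
        algebraMap (MvPolynomial (Fin 5) k ⧸ Ideal.span {f}) _ (Ideal.Quotient.mk (Ideal.span {f}) (X 4)) * Away.invSelf (Ideal.Quotient.mk (Ideal.span {f}) (X 1) ^ 2) := by
  -- abbreviations (terms only)
  let mkA : MvPolynomial (Fin 5) k →+* MvPolynomial (Fin 5) k ⧸ Ideal.span {f} := Ideal.Quotient.mk (Ideal.span {f})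
  let L := Localization.Away (mkA (X 1) ^ 2)
  let ι : (MvPolynomial (Fin 5) k ⧸ Ideal.span {f}) →+* L := algebraMap _ _
  let inv : L := Away.invSelf (mkA (X 1) ^ 2)
  have hyi : ι (mkA (X 1)) ^ 2 * inv = 1 := by
    have h := Away.mul_invSelf (S := L) (mkA (X 1) ^ 2)
    rwa [map_pow] at h
  have hF := f_rel_away k f hf
  change ι (mkA (X 4)) ^ 2 + ι (mkA (X 0)) ^ 2 * ι (mkA (X 4)) + ι (mkA (X 1)) ^ 5 + ι (mkA (X 2)) ^ 5 + ι (mkA (X 3)) ^ 5 = 0 at hF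
  -- generalize the atoms of `L`
  let y : L := ι (mkA (X 1))
  let x : L := ι (mkA (X 0))
  let u : L := ι (mkA (X 2))
  let t : L := ι (mkA (X 3))
  let z : L := ι (mkA (X 4))
  change y ^ 2 * inv = 1 at hyi
  change z ^ 2 + x ^ 2 * z + y ^ 5 + u ^ 5 + t ^ 5 = 0 at hF
  let v : Fin 4 → L := ![y, x * inv, u ^ 2 * inv, t ^ 2 * inv]
  -- level 0
  let φ₀ : MvPolynomial (Fin 4) k →+* L := eval₂Hom (ι.comp (mkA.comp MvPolynomial.C)) v
  have hφ₀X : ∀ i, φ₀ (X i) = v i := fun i => eval₂Hom_X' _ _ i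
  have hφ₀0 : φ₀ (X 0) = y := (hφ₀X 0).trans rfl
  have hφ₀1 : φ₀ (X 1) = x * inv := (hφ₀X 1).trans rfl
  have hφ₀2 : φ₀ (X 2) = u ^ 2 * inv := (hφ₀X 2).trans rfl
  have hφ₀3 : φ₀ (X 3) = t ^ 2 * inv := (hφ₀X 3).trans rfl
  -- level 1: `u`
  have e1 : h₁.eval₂ φ₀ u = 0 := by
    subst hh₁
    rw [Polynomial.eval₂_sub, Polynomial.eval₂_X_pow, Polynomial.eval₂_C, map_mul, map_pow, hφ₀0, hφ₀2]
    exact ident_sq y u inv hyi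
  let φ₁ : AdjoinRoot h₁ →+* L := AdjoinRoot.lift φ₀ u e1
  have hφ₁of : ∀ b, φ₁ (AdjoinRoot.of h₁ b) = φ₀ b := fun b => AdjoinRoot.lift_of e1
  have hφ₁root : φ₁ (AdjoinRoot.root h₁) = u := AdjoinRoot.lift_root e1
  -- level 2: `t`
  have e2 : h₂.eval₂ φ₁ t = 0 := by
    subst hh₂
    rw [Polynomial.eval₂_sub, Polynomial.eval₂_X_pow, Polynomial.eval₂_C, AdjoinRoot.algebraMap_eq, hφ₁of, map_mul, map_pow, hφ₀0, hφ₀3]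
    exact ident_sq y t inv hyi
  let φ₂ : AdjoinRoot h₂ →+* L := AdjoinRoot.lift φ₁ t e2
  have hφ₂of : ∀ b, φ₂ (AdjoinRoot.of h₂ b) = φ₁ b := fun b => AdjoinRoot.lift_of e2
  have hφ₂root : φ₂ (AdjoinRoot.root h₂) = t := AdjoinRoot.lift_root e2
  have hφ₂B : ∀ b, φ₂ (algebraMap (MvPolynomial (Fin 4) k) (AdjoinRoot h₂) b) = φ₀ b := fun b => by
    rw [IsScalarTower.algebraMap_apply (MvPolynomial (Fin 4) k) (AdjoinRoot h₁) (AdjoinRoot h₂), AdjoinRoot.algebraMap_eq, AdjoinRoot.algebraMap_eq,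
      hφ₂of, hφ₁of]
  -- level 3: `V₄ = z/ȳ²`
  have e3 : h₃.eval₂ φ₂ (z * inv) = 0 := by
    subst hh₃
    simp only [Polynomial.eval₂_add, Polynomial.eval₂_mul, Polynomial.eval₂_X_pow, Polynomial.eval₂_C, Polynomial.eval₂_X]
    simp only [map_add, map_mul, map_pow, hφ₂B, hφ₂of, hφ₁root, hφ₂root, hφ₀0, hφ₀1, hφ₀2, hφ₀3]
    exact ident_h₃ x y z u t inv hF hyi
  let φ₃ : AdjoinRoot h₃ →+* L := AdjoinRoot.lift φ₂ (z * inv) e3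
  have hφ₃of : ∀ b, φ₃ (AdjoinRoot.of h₃ b) = φ₂ b := fun b => AdjoinRoot.lift_of e3
  refine ⟨φ₃, fun a => ?_, fun i => ?_, ?_, ?_, AdjoinRoot.lift_root e3⟩
  · rw [IsScalarTower.algebraMap_apply (MvPolynomial (Fin 4) k) (AdjoinRoot h₂) (AdjoinRoot h₃), AdjoinRoot.algebraMap_eq h₃, hφ₃of, hφ₂B]
    exact eval₂Hom_C _ _ a
  · rw [IsScalarTower.algebraMap_apply (MvPolynomial (Fin 4) k) (AdjoinRoot h₂) (AdjoinRoot h₃), AdjoinRoot.algebraMap_eq h₃, hφ₃of, hφ₂B, hφ₀X]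
  · rw [IsScalarTower.algebraMap_apply (AdjoinRoot h₁) (AdjoinRoot h₂) (AdjoinRoot h₃), AdjoinRoot.algebraMap_eq h₃, AdjoinRoot.algebraMap_eq h₂,
      hφ₃of, hφ₂of, hφ₁root]
  · rw [hφ₃of, hφ₂root]

/-! ## §4 The blow-down map `ψ₁ : A₀ → T₃` -/

/-- `f(y²V₀, y, u, t, y²V₄) = 0` in `T₃` (by `ident_blowdown` and the three tower relations). [plumbing] -/
theorem blowdown_kills_f (f : MvPolynomial (Fin 5) k) (hf : f = X 4 ^ 2 + X 0 ^ 2 * X 4 + X 1 ^ 5 + X 2 ^ 5 + X 3 ^ 5)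
    (h₁ : Polynomial (MvPolynomial (Fin 4) k)) (hh₁ : h₁ = Polynomial.X ^ 2 - Polynomial.C (X 0 ^ 2 * X 2))
    (h₂ : Polynomial (AdjoinRoot h₁)) (hh₂ : h₂ = Polynomial.X ^ 2 - Polynomial.C (algebraMap (MvPolynomial (Fin 4) k) (AdjoinRoot h₁) (X 0 ^ 2 * X 3)))
    (h₃ : Polynomial (AdjoinRoot h₂))
    (hh₃ : h₃ = Polynomial.X ^ 2 + (Polynomial.C (algebraMap (MvPolynomial (Fin 4) k) (AdjoinRoot h₂) (X 0 ^ 2 * X 1 ^ 2)) * Polynomial.X +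
      Polynomial.C (algebraMap (MvPolynomial (Fin 4) k) (AdjoinRoot h₂) (X 0) +
        algebraMap (MvPolynomial (Fin 4) k) (AdjoinRoot h₂) (X 2 ^ 2) * AdjoinRoot.of h₂ (AdjoinRoot.root h₁) +
        algebraMap (MvPolynomial (Fin 4) k) (AdjoinRoot h₂) (X 3 ^ 2) * AdjoinRoot.root h₂))) :
    eval₂Hom ((algebraMap (MvPolynomial (Fin 4) k) (AdjoinRoot h₃)).comp MvPolynomial.C)
      ![algebraMap (MvPolynomial (Fin 4) k) (AdjoinRoot h₃) (X 0) ^ 2 * algebraMap (MvPolynomial (Fin 4) k) (AdjoinRoot h₃) (X 1),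
        algebraMap (MvPolynomial (Fin 4) k) (AdjoinRoot h₃) (X 0),
        algebraMap (AdjoinRoot h₁) (AdjoinRoot h₃) (AdjoinRoot.root h₁), AdjoinRoot.of h₃ (AdjoinRoot.root h₂),
        algebraMap (MvPolynomial (Fin 4) k) (AdjoinRoot h₃) (X 0) ^ 2 * AdjoinRoot.root h₃] f = 0 := by
  have R1 : algebraMap (AdjoinRoot h₁) (AdjoinRoot h₃) (AdjoinRoot.root h₁) ^ 2 =
      algebraMap (MvPolynomial (Fin 4) k) (AdjoinRoot h₃) (X 0) ^ 2 * algebraMap (MvPolynomial (Fin 4) k) (AdjoinRoot h₃) (X 2) := by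
    have h := congrArg (algebraMap (AdjoinRoot h₁) (AdjoinRoot h₃)) (root₁_sq k h₁ hh₁)
    rw [map_pow, ← AdjoinRoot.algebraMap_eq, ← IsScalarTower.algebraMap_apply, map_mul, map_pow] at h
    exact h
  have R2 : AdjoinRoot.of h₃ (AdjoinRoot.root h₂) ^ 2 =
      algebraMap (MvPolynomial (Fin 4) k) (AdjoinRoot h₃) (X 0) ^ 2 * algebraMap (MvPolynomial (Fin 4) k) (AdjoinRoot h₃) (X 3) := by
    have h := congrArg (AdjoinRoot.of h₃) (root₂_sq k h₁ h₂ hh₂)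
    rw [map_pow, ← AdjoinRoot.algebraMap_eq h₃, ← IsScalarTower.algebraMap_apply, map_mul, map_pow] at h
    exact h
  have R3 := root₃_rel k h₁ h₂ h₃ hh₃
  rw [map_mul, map_pow, map_pow, map_pow, map_pow] at R3
  generalize algebraMap (MvPolynomial (Fin 4) k) (AdjoinRoot h₃) (X 0) = y at R1 R2 R3 ⊢
  generalize algebraMap (MvPolynomial (Fin 4) k) (AdjoinRoot h₃) (X 1) = V₀ at R1 R2 R3 ⊢
  generalize algebraMap (MvPolynomial (Fin 4) k) (AdjoinRoot h₃) (X 2) = V₁ at R1 R2 R3 ⊢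
  generalize algebraMap (MvPolynomial (Fin 4) k) (AdjoinRoot h₃) (X 3) = V₂ at R1 R2 R3 ⊢
  generalize algebraMap (AdjoinRoot h₁) (AdjoinRoot h₃) (AdjoinRoot.root h₁) = u at R1 R2 R3 ⊢
  generalize AdjoinRoot.of h₃ (AdjoinRoot.root h₂) = t at R1 R2 R3 ⊢
  generalize AdjoinRoot.root h₃ = V at R1 R2 R3 ⊢
  rw [hf]
  simp only [map_add, map_mul, map_pow, eval₂Hom_X', Matrix.cons_val_zero, Matrix.cons_val_one, Matrix.cons_val]
  exact ident_blowdown y V₀ V₁ V₂ u t V R1 R2 R3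

/-- ★ **The blow-down map** `ψ₁ : A₀ →+* T₃`: `X0 ↦ y²V₀`, `X1 ↦ y`, `X2 ↦ u`, `X3 ↦ t`, `X4 ↦ y²V₄`, constants to constants (`f ↦ 0` by
`blowdown_kills_f`). [cite: GortzWedhorn2020, (13.19) p. 415] -/
theorem exists_blowdownMap (f : MvPolynomial (Fin 5) k) (hf : f = X 4 ^ 2 + X 0 ^ 2 * X 4 + X 1 ^ 5 + X 2 ^ 5 + X 3 ^ 5)
    (h₁ : Polynomial (MvPolynomial (Fin 4) k)) (hh₁ : h₁ = Polynomial.X ^ 2 - Polynomial.C (X 0 ^ 2 * X 2))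
    (h₂ : Polynomial (AdjoinRoot h₁)) (hh₂ : h₂ = Polynomial.X ^ 2 - Polynomial.C (algebraMap (MvPolynomial (Fin 4) k) (AdjoinRoot h₁) (X 0 ^ 2 * X 3)))
    (h₃ : Polynomial (AdjoinRoot h₂))
    (hh₃ : h₃ = Polynomial.X ^ 2 + (Polynomial.C (algebraMap (MvPolynomial (Fin 4) k) (AdjoinRoot h₂) (X 0 ^ 2 * X 1 ^ 2)) * Polynomial.X +
      Polynomial.C (algebraMap (MvPolynomial (Fin 4) k) (AdjoinRoot h₂) (X 0) +
        algebraMap (MvPolynomial (Fin 4) k) (AdjoinRoot h₂) (X 2 ^ 2) * AdjoinRoot.of h₂ (AdjoinRoot.root h₁) +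
        algebraMap (MvPolynomial (Fin 4) k) (AdjoinRoot h₂) (X 3 ^ 2) * AdjoinRoot.root h₂))) :
    ∃ ψ : (MvPolynomial (Fin 5) k ⧸ Ideal.span {f}) →+* AdjoinRoot h₃,
      (∀ j : Fin 5, ψ (Ideal.Quotient.mk (Ideal.span {f}) (X j)) =
        ![algebraMap (MvPolynomial (Fin 4) k) (AdjoinRoot h₃) (X 0) ^ 2 * algebraMap (MvPolynomial (Fin 4) k) (AdjoinRoot h₃) (X 1),
          algebraMap (MvPolynomial (Fin 4) k) (AdjoinRoot h₃) (X 0),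
          algebraMap (AdjoinRoot h₁) (AdjoinRoot h₃) (AdjoinRoot.root h₁), AdjoinRoot.of h₃ (AdjoinRoot.root h₂),
          algebraMap (MvPolynomial (Fin 4) k) (AdjoinRoot h₃) (X 0) ^ 2 * AdjoinRoot.root h₃] j) ∧
      (∀ a : k, ψ (Ideal.Quotient.mk (Ideal.span {f}) (C a)) = algebraMap (MvPolynomial (Fin 4) k) (AdjoinRoot h₃) (C a)) := by
  have hwf := blowdown_kills_f k f hf h₁ hh₁ h₂ hh₂ h₃ hh₃
  refine ⟨Ideal.Quotient.lift (Ideal.span {f}) (eval₂Hom ((algebraMap (MvPolynomial (Fin 4) k) (AdjoinRoot h₃)).comp MvPolynomial.C)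
    ![algebraMap (MvPolynomial (Fin 4) k) (AdjoinRoot h₃) (X 0) ^ 2 * algebraMap (MvPolynomial (Fin 4) k) (AdjoinRoot h₃) (X 1),
      algebraMap (MvPolynomial (Fin 4) k) (AdjoinRoot h₃) (X 0),
      algebraMap (AdjoinRoot h₁) (AdjoinRoot h₃) (AdjoinRoot.root h₁), AdjoinRoot.of h₃ (AdjoinRoot.root h₂),
      algebraMap (MvPolynomial (Fin 4) k) (AdjoinRoot h₃) (X 0) ^ 2 * AdjoinRoot.root h₃]) ?_,
    fun j => ?_, fun a => ?_⟩
  · intro g hg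
    obtain ⟨c, rfl⟩ := Ideal.mem_span_singleton.mp hg
    rw [map_mul, hwf, zero_mul]
  · rw [Ideal.Quotient.lift_mk, eval₂Hom_X']
  · rw [Ideal.Quotient.lift_mk, eval₂Hom_C, RingHom.comp_apply]

end Summit.ResolutionOfSingularities.ResolutionOfSingularities.Theorems.FInjectiveMacaulayfication.TauFloorF5YChartAlgebra

end
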